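import Summits.HubbardSuperconductivity.HubbardLadder.HubbardTwoPoleFrame
import HarnessLib

/-!
# A two-mode ("two-pole") Langer–Mattis lower bound for the doped Hubbard ground-state energy, II: the bounds

HONEST FRAMING (page 1): ladder R1–R4 with certified numbers; no claim on H/H₀; first certified
bounds; not a superconductivity verdict. This file is a SOUNDNESS EDGE of the pub-hubbard cell (seat
`pseudo`, `PSEUDO.md` §109 / `TO-ENG.md` §C 128): a kernel-checked lower bound on the sector
ground-state energy of the repulsive OR attractive Hubbard model at ANY filling, in certificate form,
generalising the tree's Langer–Mattis / Kennedy–Lieb bound (`LangerMattis.groundEnergyAt_ge`, which is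
sharp only at half filling and needs a bipartite graph). Part I (`HubbardTwoPoleFrame`: the frame
certificate `re_rayleigh_dGammaSpin_frame_ge`, the resolution `sum_twoPoleFrame_conj`, the Gram identity
`conjTranspose_twoPoleFrame_mul`) carries the full mechanism paragraph; this part proves
`re_rayleigh_speciesHamiltonian_ge_twoPole` (species inequality on an `N_τ` sector),
`re_rayleigh_hamiltonian_ge_twoPole` (joint sector), `groundEnergyAt_ge_twoPole` (any finite graph with a
complete FLAT hopping eigenbasis; any real `t, U`; `E_G(2n) ≥ -Σ_σ (Σ_k Re tr(T_{σ,k} M(n/|Λ|)) + μ_σ n)` for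
all `μ_σ, λ_σ ∈ ℝ` and certificates `T_{σ,k} ⪰ 0` with `C(-e_k; μ_σ, λ_σ) + T_{σ,k} ⪰ 0`) and the torus
instance `hubbardTorus_groundEnergyAt_ge_twoPole` (`(ℤ/Lℤ)^d`, `L ≥ 3`, site plane waves,
`ε_k = -siteBand t k`). All statements are PROVED (no named facts, no placeholders).
FILE SPLIT (FILER lit g33, 2026-08-26): staged seat source `pub-hubbard-pseudo/lean-staged/HubbardTwoPoleBound.lean`
sha256 3869974ba3a8f579… (pseudo g63), lines 254–448 byte-identical below; split only for the 400-line rule.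

References: Langer–Mattis, Phys. Lett. A 36 (1971) 139, eq. (5) [cite: LangerMattis1971, eq. (5)];
Lieb–Loss, Duke Math. J. 71 (1993) 337, §8 Theorem 8.2 [cite: LiebLoss1993, §8 Theorem 8.2];
Kennedy–Lieb, Physica A 138 (1986) 320, Theorem 2.1 [cite: KennedyLieb1986, Theorem 2.1];
Lieb, PRL 62 (1989) 1201, proof of Theorem 1 [cite: LiebPRL1989, proof of Theorem 1].
-/

namespace Summit.HubbardSuperconductivity.HubbardLadder

open Matrix Finset Literature.MathematicalPhysics.QuantumLattice
  Literature.MathematicalPhysics.QuantumLattice.LangerMattis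
  Literature.MathematicalPhysics.QuantumLattice.RayleighBound
open scoped ComplexOrder ComplexConjugate

section General

variable {Λ : Type*} [LinearOrder Λ] [Fintype Λ]

/-! ### The species inequality and the sector bound -/

variable (G : SimpleGraph Λ) [DecidableRel G.Adj]

/-- **The two-mode species inequality.** Let `tA_G v_k = e_k v_k` be a complete flat eigenbasis,
`σ ≠ τ`, `μ, λ ∈ ℝ`, and `T_k ⪰ 0` with `C(-e_k; μ, λ) + T_k ⪰ 0`. Then for every Fock vector `ψ`
with `N_τ ψ = n_τ ψ`:
`Re ⟨ψ, H_σ ψ⟩ ≥ -(Σ_k Re tr(T_k M(n_τ/|Λ|))) ‖ψ‖² - μ Re ⟨ψ, N_σ ψ⟩`.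
[cite: LangerMattis1971, eq. (5)][cite: LiebLoss1993, §8 Theorem 8.2] -/
theorem re_rayleigh_speciesHamiltonian_ge_twoPole [Nonempty Λ] (t U : ℝ) {σ τ : Fin 2} (hστ : σ ≠ τ)
    {κ : Type*} [Fintype κ] (v : κ → Λ → ℂ) (e : κ → ℝ)
    (hv : ∀ x y : Λ, ∑ k, v k x * star (v k y) = if x = y then 1 else 0)
    (heig : ∀ k, hopMatrix G t *ᵥ v k = ((e k : ℝ) : ℂ) • v k)
    (hflat : ∀ k x, v k x * star (v k x) = ((Fintype.card Λ : ℂ))⁻¹)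
    (μ lam : ℝ) (T : κ → Matrix (Fin 2) (Fin 2) ℂ) (hT : ∀ k, (T k).PosSemidef)
    (hCT : ∀ k, (twoPoleCost U (-(e k)) μ lam + T k).PosSemidef)
    (nτ : ℕ) (ψ : Fock (Orb Λ)) (hψ : (∑ x : Λ, numberOp x τ) *ᵥ ψ = (nτ : ℂ) • ψ) :
    -(∑ k, ((T k * twoPoleGram ((nτ : ℝ) / Fintype.card Λ)).trace).re) * normSq ψ -
        μ * (star ψ ⬝ᵥ ((∑ x : Λ, numberOp x σ) *ᵥ ψ)).re ≤
      (star ψ ⬝ᵥ (speciesHamiltonian G t U σ *ᵥ ψ)).re := by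
  classical
  -- `N_τ` commutes with the `P^τ_w`
  have hcommN : ∀ w, Commute (∑ x : Λ, numberOp x τ : Matrix (Finset (Orb Λ)) (Finset (Orb Λ)) ℂ)
      (configProj τ w) := fun w => by
    refine Commute.sum_left _ _ _ fun x _ => ?_
    rw [LiebThm1.numberOp_eq_diagonal]
    exact commute_configProj_diagonal τ _ w
  rw [rayleigh_eq_sum_configProj τ (commute_speciesHamiltonian_configProj G t U hστ) ψ, Complex.re_sum,
    ← sum_re_rayleigh_numberOp_configProj_mulVec σ τ ψ, ← sum_normSq_configProj_mulVec τ ψ,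
    Finset.mul_sum, Finset.mul_sum, ← Finset.sum_sub_distrib]
  refine Finset.sum_le_sum fun w _ => ?_
  set φ := configProj τ w *ᵥ ψ with hφ
  by_cases hw : w.card = nτ
  · -- on the block, `H_σ` acts as `dΓ_σ(A_w) = Σ_k dΓ_σ(F_k C_k F_kᴴ) - μ N_σ`
    have hact : speciesHamiltonian G t U σ *ᵥ φ = dGammaSpin σ (lmOneBody G t U w) *ᵥ φ := by
      rw [hφ, mulVec_mulVec, mulVec_mulVec, speciesHamiltonian_mul_configProj G t U hστ w]
    have hsplit : dGammaSpin σ (lmOneBody G t U w) =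
        (∑ k, dGammaSpin σ (twoPoleFrame (v k) w * twoPoleCost U (-(e k)) μ lam *
          (twoPoleFrame (v k) w)ᴴ)) - ((μ : ℝ) : ℂ) • ∑ x : Λ, numberOp x σ := by
      rw [← dGammaSpin_sum, sum_twoPoleFrame_conj G t U μ lam w v e hv heig, dGammaSpin_add,
        dGammaSpin_smul, dGammaSpin_one, add_sub_cancel_right]
    have hgram : ∀ k, (twoPoleFrame (v k) w)ᴴ * twoPoleFrame (v k) w =
        twoPoleGram ((nτ : ℝ) / Fintype.card Λ) := fun k => by
      rw [conjTranspose_twoPoleFrame_mul (v k) w (hflat k) Fintype.card_pos, hw]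
    have hk : ∀ k, -(((T k * twoPoleGram ((nτ : ℝ) / Fintype.card Λ)).trace).re) * normSq φ ≤
        (star φ ⬝ᵥ (dGammaSpin σ (twoPoleFrame (v k) w * twoPoleCost U (-(e k)) μ lam *
          (twoPoleFrame (v k) w)ᴴ) *ᵥ φ)).re := fun k => by
      rw [← hgram k]
      exact re_rayleigh_dGammaSpin_frame_ge σ _ (hT k) (hCT k) φ
    have hsum := Finset.sum_le_sum fun k (_ : k ∈ Finset.univ) => hk k
    rw [← Finset.sum_mul, Finset.sum_neg_distrib] at hsum
    have hre_sum : (star φ ⬝ᵥ ((∑ k, dGammaSpin σ (twoPoleFrame (v k) w * twoPoleCost U (-(e k)) μ lam *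
        (twoPoleFrame (v k) w)ᴴ)) *ᵥ φ)).re = ∑ k, (star φ ⬝ᵥ (dGammaSpin σ (twoPoleFrame (v k) w *
          twoPoleCost U (-(e k)) μ lam * (twoPoleFrame (v k) w)ᴴ) *ᵥ φ)).re := by
      rw [Matrix.sum_mulVec, dotProduct_sum, Complex.re_sum]
    rw [hact, hsplit, Matrix.sub_mulVec, dotProduct_sub, Complex.sub_re, hre_sum, Matrix.smul_mulVec,
      dotProduct_smul, smul_eq_mul, Complex.re_ofReal_mul]
    linarith
  · -- the block is empty: `N_τ φ = |w| φ = n_τ φ` with `|w| ≠ n_τ`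
    have hφ0 : φ = 0 := by
      have h1 : (∑ x : Λ, numberOp x τ) *ᵥ φ = (w.card : ℂ) • φ :=
        sum_numberOp_mulVec_configProj_mulVec τ w ψ
      have h2 : (∑ x : Λ, numberOp x τ) *ᵥ φ = (nτ : ℂ) • φ := by
        rw [hφ, mulVec_mulVec, (hcommN w).eq, ← mulVec_mulVec, hψ, mulVec_smul]
      have h3 : ((w.card : ℂ) - nτ) • φ = 0 := by rw [sub_smul, ← h1, ← h2, sub_self]
      rcases smul_eq_zero.1 h3 with h | h
      · exact absurd (by exact_mod_cast sub_eq_zero.1 h) hw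
      · exact h
    have hn0 : normSq (0 : Fock (Orb Λ)) = 0 := by simp [normSq]
    simp [hφ0, hn0]

/-- **The two-mode operator inequality on a joint sector** `N_↑ ψ = n_0 ψ`, `N_↓ ψ = n_1 ψ` (any
`n_0, n_1`; species `σ` is priced with the Gram matrix of the OTHER species' density `n_{1-σ}/|Λ|`):
`Re ⟨ψ, H ψ⟩ ≥ -(Σ_σ (Σ_k Re tr(T_{σ,k} M(n_{1-σ}/|Λ|)) + μ_σ n_σ)) ‖ψ‖²`.
[cite: LangerMattis1971, eq. (5)][cite: LiebLoss1993, §8 Theorem 8.2] -/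
theorem re_rayleigh_hamiltonian_ge_twoPole [Nonempty Λ] (t U : ℝ) {κ : Type*} [Fintype κ]
    (v : κ → Λ → ℂ) (e : κ → ℝ) (hv : ∀ x y : Λ, ∑ k, v k x * star (v k y) = if x = y then 1 else 0)
    (heig : ∀ k, hopMatrix G t *ᵥ v k = ((e k : ℝ) : ℂ) • v k)
    (hflat : ∀ k x, v k x * star (v k x) = ((Fintype.card Λ : ℂ))⁻¹)
    (μ lam : Fin 2 → ℝ) (T : Fin 2 → κ → Matrix (Fin 2) (Fin 2) ℂ)
    (hT : ∀ σ k, (T σ k).PosSemidef)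
    (hCT : ∀ σ k, (twoPoleCost U (-(e k)) (μ σ) (lam σ) + T σ k).PosSemidef)
    (n : Fin 2 → ℕ) (ψ : Fock (Orb Λ)) (hψ : ∀ σ, (∑ x : Λ, numberOp x σ) *ᵥ ψ = (n σ : ℂ) • ψ) :
    -((∑ k, ((T 0 k * twoPoleGram ((n 1 : ℝ) / Fintype.card Λ)).trace).re) + μ 0 * n 0 +
        ((∑ k, ((T 1 k * twoPoleGram ((n 0 : ℝ) / Fintype.card Λ)).trace).re) + μ 1 * n 1)) * normSq ψ ≤
      (star ψ ⬝ᵥ (hamiltonian G t U *ᵥ ψ)).re := by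
  have hre : ∀ σ : Fin 2, (star ψ ⬝ᵥ ((∑ x : Λ, numberOp x σ) *ᵥ ψ)).re = n σ * normSq ψ := fun σ => by
    rw [hψ σ, dotProduct_smul, star_dotProduct_self_eq_normSq, smul_eq_mul, ← Complex.ofReal_natCast,
      ← Complex.ofReal_mul, Complex.ofReal_re]
  have h0 := re_rayleigh_speciesHamiltonian_ge_twoPole G t U (σ := 0) (τ := 1) (by decide) v e hv heig
    hflat (μ 0) (lam 0) (T 0) (hT 0) (hCT 0) (n 1) ψ (hψ 1)
  have h1 := re_rayleigh_speciesHamiltonian_ge_twoPole G t U (σ := 1) (τ := 0) (by decide) v e hv heig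
    hflat (μ 1) (lam 1) (T 1) (hT 1) (hCT 1) (n 0) ψ (hψ 0)
  rw [hre] at h0 h1
  rw [hamiltonian_eq_add_speciesHamiltonian, add_mulVec, dotProduct_add, Complex.add_re]
  have e0 : μ 0 * (↑(n 0) * normSq ψ) = (μ 0 * n 0) * normSq ψ := by ring
  have e1 : μ 1 * (↑(n 1) * normSq ψ) = (μ 1 * n 1) * normSq ψ := by ring
  nlinarith [h0, h1, e0, e1]

/-- **The two-mode lower bound on the `2n`-particle ground-state energy** (any finite graph with a
complete flat hopping eigenbasis `tA_G v_k = e_k v_k`, `|v_k(x)|² = 1/|Λ|`; any real `t, U`; any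
`n ≤ |Λ|`): for all `μ_σ, λ_σ ∈ ℝ` and certificates `T_{σ,k} ⪰ 0` with `C(-e_k; μ_σ, λ_σ) + T_{σ,k} ⪰ 0`,
`E_G(2n) ≥ -Σ_σ (Σ_k Re tr(T_{σ,k} M(n/|Λ|)) + μ_σ n)`.
(The `(n, n)` sector carries `E_G(2n)`, `groundEnergyAt_eq_minEnergyOn_szSector`.)
[cite: LangerMattis1971, eq. (5)][cite: LiebLoss1993, §8 Theorem 8.2][cite: LiebPRL1989, proof of Theorem 1] -/
theorem groundEnergyAt_ge_twoPole [Nonempty Λ] (t U : ℝ) {κ : Type*} [Fintype κ] (v : κ → Λ → ℂ)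
    (e : κ → ℝ) (hv : ∀ x y : Λ, ∑ k, v k x * star (v k y) = if x = y then 1 else 0)
    (heig : ∀ k, hopMatrix G t *ᵥ v k = ((e k : ℝ) : ℂ) • v k)
    (hflat : ∀ k x, v k x * star (v k x) = ((Fintype.card Λ : ℂ))⁻¹)
    (μ lam : Fin 2 → ℝ) (T : Fin 2 → κ → Matrix (Fin 2) (Fin 2) ℂ)
    (hT : ∀ σ k, (T σ k).PosSemidef)
    (hCT : ∀ σ k, (twoPoleCost U (-(e k)) (μ σ) (lam σ) + T σ k).PosSemidef)
    {n : ℕ} (hn : n ≤ Fintype.card Λ) :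
    -(∑ σ : Fin 2, ((∑ k, ((T σ k * twoPoleGram ((n : ℝ) / Fintype.card Λ)).trace).re) + μ σ * n)) ≤
      groundEnergyAt G t U (2 * n) := by
  classical
  rw [groundEnergyAt_eq_minEnergyOn_szSector G t U hn, Matrix.minEnergyOn]
  obtain ⟨⟨ψ₁, hψ₁K, hψ₁0, -⟩, -⟩ := szSector_groundState G t U hn
  obtain ⟨c, -, hc1⟩ := exists_smul_unit hψ₁0
  refine le_csInf ⟨_, c • ψ₁, Submodule.smul_mem _ c hψ₁K, hc1, rfl⟩ ?_
  rintro E ⟨ψ, hψK, hψ1, rfl⟩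
  have hNσ : ∀ σ : Fin 2, (∑ x : Λ, numberOp x σ) *ᵥ ψ = (n : ℂ) • ψ := fun σ => by
    rw [spinNumber_mulVec_of_mem_szSector σ hψK]
    congr 1
    push_cast
    ring
  have hnorm : normSq ψ = 1 := by
    have h := star_dotProduct_self_eq_normSq ψ
    rw [hψ1] at h
    exact_mod_cast h.symm
  have hre : ∀ σ : Fin 2, (star ψ ⬝ᵥ ((∑ x : Λ, numberOp x σ) *ᵥ ψ)).re = n := fun σ => by
    rw [hNσ σ, dotProduct_smul, hψ1, smul_eq_mul, mul_one, Complex.natCast_re]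
  have h0 := re_rayleigh_speciesHamiltonian_ge_twoPole G t U (σ := 0) (τ := 1) (by decide) v e hv heig
    hflat (μ 0) (lam 0) (T 0) (hT 0) (hCT 0) n ψ (hNσ 1)
  have h1 := re_rayleigh_speciesHamiltonian_ge_twoPole G t U (σ := 1) (τ := 0) (by decide) v e hv heig
    hflat (μ 1) (lam 1) (T 1) (hT 1) (hCT 1) n ψ (hNσ 0)
  rw [hre, hnorm, mul_one] at h0 h1
  rw [hamiltonian_eq_add_speciesHamiltonian, add_mulVec, dotProduct_add, Complex.add_re, Fin.sum_univ_two]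
  linarith

end General

/-! ### The torus `(ℤ/Lℤ)^d`: site plane waves -/

section Torus

open Literature.Probability.LatticeModels

variable {d L : ℕ} [NeZero L]

/-- **The two-mode bound on the Hubbard torus** `(ℤ/Lℤ)^d`, `L ≥ 3`, any real `t, U`, `n ≤ L^d`:
with `ε_k = -2t Σ_i cos(2πk_i/L)` the kinetic levels (`= -siteBand t k`), for all `μ_σ, λ_σ ∈ ℝ` and
`T_{σ,k} ⪰ 0` with `[[ε_k + μ_σ, λ_σ/2], [λ_σ/2, U/2 - λ_σ]] + T_{σ,k} ⪰ 0`,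
`E_L(2n) ≥ -Σ_σ (Σ_k Re tr(T_{σ,k} M(n/L^d)) + μ_σ n)`.
[cite: LangerMattis1971, eq. (5)][cite: LiebLoss1993, §8 Theorem 8.2][cite: LiebPRL1989, proof of Theorem 1] -/
theorem hubbardTorus_groundEnergyAt_ge_twoPole (hL : 3 ≤ L) (t U : ℝ) (μ lam : Fin 2 → ℝ)
    (T : Fin 2 → FermionTorus d L → Matrix (Fin 2) (Fin 2) ℂ) (hT : ∀ σ k, (T σ k).PosSemidef)
    (hCT : ∀ σ k, (twoPoleCost U (-(siteBand t k)) (μ σ) (lam σ) + T σ k).PosSemidef)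
    {n : ℕ} (hn : n ≤ L ^ d) :
    -(∑ σ : Fin 2, ((∑ k, ((T σ k * twoPoleGram ((n : ℝ) / (L : ℝ) ^ d)).trace).re) + μ σ * n)) ≤
      groundEnergyAt (fermionTorusGraph d L) t U (2 * n) := by
  classical
  haveI : Nonempty (FermionTorus d L) := ⟨toLex fun _ => 0⟩
  have hcard : Fintype.card (FermionTorus d L) = L ^ d := card_fermionTorus_eq
  have hcardR : ((L : ℝ) ^ d) = (Fintype.card (FermionTorus d L) : ℝ) := by
    rw [hcard]; push_cast; rfl
  -- the site plane waves `v_k(x) = W_{x,k}`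
  set v : FermionTorus d L → FermionTorus d L → ℂ := fun k x => sitePlaneWave d L x k with hvdef
  have hv : ∀ x y, ∑ k, v k x * star (v k y) = if x = y then 1 else 0 := fun x y => by
    have h := congrFun (congrFun (sitePlaneWave_mul_conjTranspose (d := d) (L := L)) x) y
    rw [Matrix.mul_apply, Matrix.one_apply] at h
    simpa only [hvdef, Matrix.conjTranspose_apply] using h
  have heig : ∀ k, hopMatrix (fermionTorusGraph d L) t *ᵥ v k = ((siteBand t k : ℝ) : ℂ) • v k :=
    fun k => by
    funext x
    have h := congrFun (congrFun (hopMatrix_mul_sitePlaneWave (d := d) hL t) x) k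
    rw [Matrix.mul_apply, mul_diagonal] at h
    rw [Pi.smul_apply, smul_eq_mul, hvdef, mulVec, dotProduct]
    simp only
    rw [h, mul_comm]
  have hflat : ∀ k x, v k x * star (v k x) = ((Fintype.card (FermionTorus d L) : ℂ))⁻¹ := fun k x => by
    simp only [hvdef, sitePlaneWave, Matrix.of_apply, star_mul', star_torusFourierWeight, Complex.star_def]
    rw [hcard]
    push_cast
    rw [← torusFourierWeight_mul_self (d := d) (L := L)]
    linear_combination (torusFourierWeight d L * torusFourierWeight d L) *
      torusChar_mul_conj k.toTorusSite x.toTorusSite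
  have h := groundEnergyAt_ge_twoPole (fermionTorusGraph d L) t U v (fun k => siteBand t k)
    (fun x y => by convert hv x y using 2) heig hflat μ lam T hT hCT (n := n) (by rw [hcard]; exact hn)
  rw [← hcardR] at h
  exact h

end Torus

end Summit.HubbardSuperconductivity.HubbardLadder
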